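import Literature.Probability.LatticeModels.IsingAnnulusCircuitGeometry
import Literature.Probability.LatticeModels.ZhangCrossing
import Literature.Probability.Percolation.LatticeSymmetry
import HarnessLib

/-!
# Crossing of a strip by a lattice walk and a `∗`-walk in opposite orders

Topic `Probability/Percolation`. A planar-duality lemma for the matching pair `(ℤ², ℤ²∗)` in a
horizontal strip `{B ≤ x₂ ≤ T}`: if a lattice walk `P` and a `∗`-walk `Q` both cross the strip from
its bottom row to its top row, every bottom-row vertex of `Q` lies strictly to the left of every
bottom-row vertex of `P`, and every top-row vertex of `P` lies strictly to the left of every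
top-row vertex of `Q`, then `P` and `Q` have a common vertex (`exists_mem_support_of_strip_crossings`).

This is the form in which the non-crossing of `+∗`paths and `−`paths is used for the semi-infinite
interfaces of Georgii–Higuchi 2000, §5 (Lemmas 5.3/5.4: an interface which is to the left of another
one at some level and to the right of it at a higher level must meet it). It is reduced to the
rectangle-crossing lemma `exists_mem_support_of_crossing_star` (a lattice left-right crossing meets a
`∗` top-bottom crossing) by extending `Q` along the bottom and top rows to a left-right crossing and
transposing the coordinates (`transposeIso`, `starTransposeHom`).

## References

* H.-O. Georgii, Y. Higuchi, *Percolation and number of phases in the two-dimensional Ising model*,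
  J. Math. Phys. 41 (2000), §5 [GeorgiiHiguchi2000].
* H. Kesten, *Percolation theory for mathematicians* (1982), §2.2 (matching pairs) [Kesten1982].
-/

noncomputable section

open SimpleGraph
open Literature.Probability.LatticeModels

namespace Literature.Probability.Percolation

/-! ### Horizontal runs -/

/-- The vertices of the horizontal run of `k` steps to the right from `z`. [folklore] -/
theorem mem_support_rightRun {z w : Site 2} {k : ℕ} :
    w ∈ (Zhang.stepRun (Pi.single 0 1) Zhang.adj_add_unitStep.1 z k).support ↔
      z 0 ≤ w 0 ∧ w 0 ≤ z 0 + k ∧ w 1 = z 1 := by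
  rw [Zhang.mem_support_stepRun]
  simp only [Pi.single_eq_same, mul_one, Pi.single_eq_of_ne (show (1 : Fin 2) ≠ 0 by decide), mul_zero,
    add_zero]
  constructor
  · rintro ⟨j, hj, h0, h1⟩
    exact ⟨by omega, by omega, h1⟩
  · rintro ⟨h0, h0', h1⟩
    refine ⟨(w 0 - z 0).toNat, by omega, by omega, h1⟩

/-- The vertices of the horizontal run of `k` steps to the left from `z`. [folklore] -/
theorem mem_support_leftRun {z w : Site 2} {k : ℕ} :
    w ∈ (Zhang.stepRun (-Pi.single 0 1) Zhang.adj_add_unitStep.2.1 z k).support ↔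
      z 0 - k ≤ w 0 ∧ w 0 ≤ z 0 ∧ w 1 = z 1 := by
  rw [Zhang.mem_support_stepRun]
  simp only [Pi.neg_apply, Pi.single_eq_same, mul_neg, mul_one,
    Pi.single_eq_of_ne (show (1 : Fin 2) ≠ 0 by decide), neg_zero, mul_zero, add_zero]
  constructor
  · rintro ⟨j, hj, h0, h1⟩
    exact ⟨by omega, by omega, h1⟩
  · rintro ⟨h0, h0', h1⟩
    refine ⟨(z 0 - w 0).toNat, by omega, by omega, h1⟩

/-- Endpoint coordinates of a run. [folklore] -/
theorem iterate_right_apply (z : Site 2) (k : ℕ) :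
    ((fun w : Site 2 => w + Pi.single 0 1)^[k] z) 0 = z 0 + k ∧
      ((fun w : Site 2 => w + Pi.single 0 1)^[k] z) 1 = z 1 := by
  refine ⟨?_, ?_⟩ <;> rw [Zhang.iterate_add_apply] <;> simp

/-- Endpoint coordinates of a run. [folklore] -/
theorem iterate_left_apply (z : Site 2) (k : ℕ) :
    ((fun w : Site 2 => w + -Pi.single 0 1)^[k] z) 0 = z 0 - k ∧
      ((fun w : Site 2 => w + -Pi.single 0 1)^[k] z) 1 = z 1 := by
  refine ⟨?_, ?_⟩ <;> rw [Zhang.iterate_add_apply] <;> simp; ring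

/-! ### The strip lemma -/

/-- **Opposite orders at the two ends of a strip force a crossing.** Let `P` be a lattice walk and
`Q` a `∗`-walk inside the strip `{B ≤ x₂ ≤ T}`, both from the bottom row to the top row. If every
bottom-row vertex of `Q` is strictly to the left of every bottom-row vertex of `P`, and every
top-row vertex of `P` is strictly to the left of every top-row vertex of `Q`, then `P` and `Q`
share a vertex (matching-pair planarity, Kesten 1982 §2.2; the form used for the interfaces of
Georgii–Higuchi 2000, §5). [cite: GeorgiiHiguchi2000, §5 (Lemmas 5.3–5.4, proofs)] -/
theorem exists_mem_support_of_strip_crossings {B T : ℤ} {a b c d : Site 2}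
    (P : (zdGraph 2).Walk a b) (Q : zdStarGraph.Walk c d)
    (hP : ∀ z ∈ P.support, B ≤ z 1 ∧ z 1 ≤ T) (hQ : ∀ z ∈ Q.support, B ≤ z 1 ∧ z 1 ≤ T)
    (ha : a 1 = B) (hb : b 1 = T) (hc : c 1 = B) (hd : d 1 = T)
    (hbot : ∀ z ∈ Q.support, z 1 = B → ∀ w ∈ P.support, w 1 = B → z 0 < w 0)
    (htop : ∀ w ∈ P.support, w 1 = T → ∀ z ∈ Q.support, z 1 = T → w 0 < z 0) :
    ∃ z ∈ P.support, z ∈ Q.support := by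
  classical
  -- column bounds
  obtain ⟨M, hM⟩ := ((P.support ++ Q.support).toFinset.image fun z : Site 2 => z 0).bddAbove
  obtain ⟨M', hM'⟩ := ((P.support ++ Q.support).toFinset.image fun z : Site 2 => z 0).bddBelow
  have hcolP : ∀ z ∈ P.support, M' ≤ z 0 ∧ z 0 ≤ M := fun z hz =>
    ⟨hM' (Finset.mem_image.2 ⟨z, List.mem_toFinset.2 (List.mem_append_left _ hz), rfl⟩),
      hM (Finset.mem_image.2 ⟨z, List.mem_toFinset.2 (List.mem_append_left _ hz), rfl⟩)⟩
  have hcolQ : ∀ z ∈ Q.support, M' ≤ z 0 ∧ z 0 ≤ M := fun z hz =>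
    ⟨hM' (Finset.mem_image.2 ⟨z, List.mem_toFinset.2 (List.mem_append_right _ hz), rfl⟩),
      hM (Finset.mem_image.2 ⟨z, List.mem_toFinset.2 (List.mem_append_right _ hz), rfl⟩)⟩
  set L := M' - 1 with hL
  set R := M + 1 with hR
  have hcM := hcolQ c (Walk.start_mem_support Q)
  have hdM := hcolQ d (Walk.end_mem_support Q)
  -- the runs
  set k : ℕ := (c 0 - L).toNat with hk
  set k' : ℕ := (R - d 0).toNat with hk'
  have hkc : (k : ℤ) = c 0 - L := by rw [hk, Int.toNat_of_nonneg (by omega)]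
  have hkd : (k' : ℤ) = R - d 0 := by rw [hk', Int.toNat_of_nonneg (by omega)]
  let runB := Zhang.stepRun (-Pi.single 0 1) Zhang.adj_add_unitStep.2.1 c k
  let runT := Zhang.stepRun (Pi.single 0 1) Zhang.adj_add_unitStep.1 d k'
  have hc'0 : ((fun w : Site 2 => w + -Pi.single 0 1)^[k] c) 0 = L := by rw [(iterate_left_apply c k).1, hkc]; ring
  have hc'1 : ((fun w : Site 2 => w + -Pi.single 0 1)^[k] c) 1 = B := by rw [(iterate_left_apply c k).2, hc]
  have hd'0 : ((fun w : Site 2 => w + Pi.single 0 1)^[k'] d) 0 = R := by rw [(iterate_right_apply d k').1, hkd]; ring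
  have hd'1 : ((fun w : Site 2 => w + Pi.single 0 1)^[k'] d) 1 = T := by rw [(iterate_right_apply d k').2, hd]
  let Qt : zdStarGraph.Walk ((fun w : Site 2 => w + -Pi.single 0 1)^[k] c) ((fun w : Site 2 => w + Pi.single 0 1)^[k'] d) :=
    ((runB.reverse.mapLe zdGraph_le_zdStarGraph).append Q).append (runT.mapLe zdGraph_le_zdStarGraph)
  have hQtsupp : ∀ z, z ∈ Qt.support ↔ z ∈ runB.support ∨ z ∈ Q.support ∨ z ∈ runT.support := by
    intro z
    simp only [Qt, Walk.mem_support_append_iff, Walk.support_mapLe_eq_support, Walk.support_reverse,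
      List.mem_reverse]
    tauto
  have hBT : B ≤ T := by
    have := hP a (Walk.start_mem_support P); omega
  have hQtbd : ∀ z ∈ Qt.support, (L ≤ z 0 ∧ z 0 ≤ R) ∧ (B ≤ z 1 ∧ z 1 ≤ T) := by
    intro z hz
    rcases (hQtsupp z).1 hz with h | h | h
    · rw [mem_support_leftRun] at h
      refine ⟨⟨by rw [hkc] at h; linarith [h.1], by linarith [h.2.1, hcM.2]⟩, ?_⟩
      rw [h.2.2, hc]; exact ⟨le_rfl, hBT⟩
    · exact ⟨⟨by linarith [(hcolQ z h).1], by linarith [(hcolQ z h).2]⟩, hQ z h⟩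
    · rw [mem_support_rightRun] at h
      refine ⟨⟨by linarith [h.1, hdM.1], by rw [hkd] at h; linarith [h.2.1]⟩, ?_⟩
      rw [h.2.2, hd]; exact ⟨hBT, le_rfl⟩
  -- transpose
  let P' := P.map transposeIso.toHom
  let Q' := Qt.map starTransposeHom
  have hsuppP' : ∀ z, z ∈ P'.support ↔ ∃ w ∈ P.support, (transposeIso w : Site 2) = z := fun z => by
    rw [Walk.support_map, List.mem_map]; rfl
  have hsuppQ' : ∀ z, z ∈ Q'.support ↔ ∃ w ∈ Qt.support, starTransposeHom w = z := fun z => by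
    rw [Walk.support_map, List.mem_map]
  obtain ⟨z, hzP', hzQ'⟩ := exists_mem_support_of_crossing_star (L := B) (R := T) (B := L) (T := R) P' Q'
    (fun z hz => by
      obtain ⟨w, hw, rfl⟩ := (hsuppP' z).1 hz
      rw [transposeIso_apply_zero, transposeIso_apply_one]
      exact ⟨(hP w hw).1, (hP w hw).2, by linarith [(hcolP w hw).1], by linarith [(hcolP w hw).2]⟩)
    (fun z hz => by
      obtain ⟨w, hw, rfl⟩ := (hsuppQ' z).1 hz
      rw [starTransposeHom_apply_zero, starTransposeHom_apply_one]
      exact ⟨(hQtbd w hw).2.1, (hQtbd w hw).2.2, (hQtbd w hw).1.1, (hQtbd w hw).1.2⟩)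
    (by change transposeIso a 0 = B; rw [transposeIso_apply_zero, ha])
    (by change transposeIso b 0 = T; rw [transposeIso_apply_zero, hb])
    (by rw [starTransposeHom_apply_one, hc'0])
    (by rw [starTransposeHom_apply_one, hd'0])
  obtain ⟨w, hwP, rfl⟩ := (hsuppP' z).1 hzP'
  obtain ⟨v, hvQ, hvw⟩ := (hsuppQ' _).1 hzQ'
  rw [transposeIso_apply_eq] at hvw
  obtain rfl : v = w := starTransposeHom_injective hvw
  rcases (hQtsupp v).1 hvQ with h | h | h
  · -- on the bottom run: a bottom-row vertex of `P` at column `≤ c 0`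
    rw [mem_support_leftRun] at h
    have h1 : v 1 = B := by rw [h.2.2, hc]
    have := hbot c (Walk.start_mem_support Q) hc v hwP h1
    exact absurd h.2.1 (by omega)
  · exact ⟨v, hwP, h⟩
  · rw [mem_support_rightRun] at h
    have h1 : v 1 = T := by rw [h.2.2, hd]
    have := htop v hwP h1 d (Walk.end_mem_support Q) hd
    exact absurd h.1 (by omega)

end Literature.Probability.Percolation
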